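import Summits.QuantumFields.YangMills.Theorems.BalabanUVNodesN07ShearLetterOfFine
import Summits.QuantumFields.YangMills.Theorems.BalabanUVNodesN07TildeTowerLettersAtToken
import HarnessLib

/-!
# N07 [B11] (= [15] = [Balaban1985Variational]) Sect. F, road of record R0′, WIDTH-209 row (r2), FILE 20: **THE ς-DOOR AT A TOKEN DATUM** — FILE 18's door at the S6 head's token
# binders with the data-lane inputs DISCHARGED by dag-n07-w6 g3's `N07TildeTowerLettersAtToken` (the radial shear gauge `u♮` ∃-chosen, its radial tower, the top letter on `□̃^{(K−n)}`,
# the `α₀`-ranges at `α₀ := L²ε(K−n−1)`, the widened-`□̃` fine regularity from the (17) clause one level down): the shear row then reads the token's own binders, S3's letters on `□̃`,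
# and ONE affine inequality

Cell `pub-ymgap`, width seat `pub-ymgap-dag-n07-w8` g6, WIDTH-209 N07 row (r2) of road R0′, CLAIM-20 ∕ INTENT-20 (cell bus; own lineage FILE 18 → FILE 20; dag-n07-w6 g3's
`N07TildeTowerLettersAtToken` CONSUMED BY NAME on their explicit invitation I.≈40180).  `--kind proof --supports stmt-QuantumFields-27364 --as helper` (K1⁹ per dag-lead KEY MAP v2);
count-neutral; def-free.  [15] = [Balaban1985Variational] (17) p. 279, (144)–(147) pp. 300–301, (150)–(152) p. 301, (157)–(159) pp. 302–303, (164)–(165) p. 304, (168) p. 304;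
[6] = [Balaban1985RegularSpaces] p. 98, Lemma 1 (1.25) p. 79; [B7] = [Balaban1985Averaging] Prop. 2 p. 22; [4] = [Balaban1984PropagatorsII] (2.1)–(2.4) p. 224, Cor. 2.8 p. 249.

THE POINT.  FILE 18 displays four data-lane binders: `α₀` with its ranges, the widened-`□̃` fine regularity `h52`, the radial WLOG `hax` of the representative `(U^{u})^{u♮}` and its top letter
`htop`.  dag-n07-w6 g3's `exists_shearGauge_radialRep_rows_at_token` produces, at the token's binders (floor `F.L·(Mc + 44 + 4ρ + 2(F.L + (8F.L+2))) + 3 ≤ c ≤ ν.M₁`, period letter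
`Mc + 44 + 6ρ + 1 ≤ 2F.L^{c₀}`, `k + c₀ ≤ F.m + K`, the two `a₀`-smallness letters, radii `0 < ε(m) ≤ a₀`, the (17) clauses on `omegaPlaqsTop s.Ω (suppDomOfRecord …) m`, the datum's
box-form meet) and for ANY S3 gauge `u`, a shear gauge `u♮` with the radial tower of `(U^{u})^{u♮}` below `K − n` and the `□̃`-tower rows (top row = `v_k := (d−1)(M′+4ρ−1)·2L²ε(K−n−1)`),
while `plaqSmallOn_tildeTowerWide_at_token` and `alpha_ranges_of_le` give `h52` and the ranges at `α₀ := L²ε(K−n−1)`.  THIS FILE: `∃ u♮` such that FOR EVERY shift family dominated by the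
(r1) letters of `u♮` and every (159)-splitting, FILE 18's clause holds — shear side displaying ONLY the token's binders, S3's `(u, A, t)` on `□′` and on `□̃` (LOCATED-LANDAU-REGION), and
`2d(M′+4ρ+1)(4κL²ε(K−n−1) + (d−1)(M′+4ρ−1)·2L²ε(K−n−1) + 2t) ≤ ½`.

WHAT IS PROVED (sorry-free; no definition; axioms standard).  ★★★★ `localGaugeSplitOn_of_gauge152_recordShearTildeTower_at_token_cubeDomains_box F N`.
HONEST SCOPE.  Count-neutral by-name composition of LANDED theorems (FILE 18; dag-n07-w6 g3 `N07TildeTowerLettersAtToken` §1–§3); every displayed binder a hypothesis; nothing of [15]∕[6]∕[B7]∕[4]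
ANALYSIS asserted beyond the landed ports; joint satisfiability with the head's budget NOT claimed; HCHART ∕ `LocalLettersSplitTopStepCore(G∕R)` ∕ `DatumGaugeSplitTopStepCore(G∕R)` ∕ `HalvingStepTop(Core)` ∕
`stub_prop8StepCoP13` NOT discharged; K0⁷ ∕ K1⁹ NOT closed; N07 NOT discharged; counts unmoved (typed 28∕28 · discharged 5∕27); one finite 𝕋⁴ programme at fixed ε — the route closes the
conditional finite-𝕋⁴ rung `BalabanLadder.UV` ONLY; the YM mass gap (Clay) is NOT proved by any of this; nothing continuum ∕ ℝ⁴ ∕ OS.  No `sorry`, no `def`, no `instance`, no `notation`.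

RELATED IN THE TREE, NOT DUPLICATED (stem check: `ls …/Theorems | rg -i 'ShearLetterAtToken|LetterAtToken'` — dag-n07-w6 g3's file is `…TildeTowerLettersAtToken`, distinct stem): FILE 18∕19 (CONSUMED ∕ sibling
at a generic datum); dag-n07-w6 g3 `N07TildeTowerLettersAtToken` (the `v`-rows at the token — the OTHER half; its §1–§3 CONSUMED).
-/

set_option autoImplicit false

noncomputable section
open scoped BigOperators Matrix.Norms.L2Operator

namespace Summit.QuantumFields.YangMills.BalabanUVNodes.N07ShearLetterAtToken

open Literature.MathematicalPhysics.QuantumFieldTheory.Balaban1983to89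
open Literature.MathematicalPhysics.QuantumFieldTheory.Balaban1983to89.Node00
open Literature.MathematicalPhysics.QuantumFieldTheory.Balaban1983to89.B12RegularSpaces111 (gaugeU expI grad)
open B15Eq112TorusCover (cover)
open B14DomainGeom (Pt Within)
open B8Eq131Cubes (gs sqLo sqHi tLo tHi box cube)
open B8Ineq130 (tlo thi)
open B6SectAOperatorsV1 (BondIdx)
open T4Continuum (T4Family)
open T4AxialGaugeSmallField (castSite)
open B16Sect1Backgrounds (toMS)
open GaugeField (gaugeAct)
open MatrixLog (mlog)
open ExpMeanLog (deltaSU)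
open Summit.QuantumFields.Balaban3D.Carriers (radialContourData)
open Summit.QuantumFields.YangMills.Theorems.K0FlatCubeOpsTextP (flatH)
open Summit.QuantumFields.YangMills.BalabanUVNodes.N07HalvingStepTopOfLocalLetters (Letters10On)
open Summit.QuantumFields.YangMills.BalabanUVNodes.N07LocalLettersSplitCore (LocalGaugeSplitOn)
open Summit.QuantumFields.YangMills.BalabanUVNodes.N07ShearLetterOfFine (localGaugeSplitOn_of_gauge152_recordShearTildeTower_of_fine_cubeDomains_box)
open Summit.QuantumFields.YangMills.BalabanUVNodes.N07TildeTowerLettersAtToken (plaqSmallOn_tildeTowerWide_at_token alpha_ranges_of_le exists_shearGauge_radialRep_rows_at_token)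

open scoped Classical in
/-- ★★★★ **THE ς-DOOR AT A TOKEN DATUM** (FILE 18 ∘ dag-n07-w6 g3): at the token's binders and the datum `(Mc, ρ, idx)` of level `K − n`, for every S3 gauge `u` of `U` with its letters on `□′`
and on `□̃`, THERE IS a shear gauge `u♮` — the radial one of `(U^{u})` — such that for every shift family dominated by its (r1) letters and every (159)-splitting, the split clause holds on `π '' □′`
whenever `2d(M′+4ρ+1)(4κL²ε(K−n−1) + (d−1)(M′+4ρ−1)·2L²ε(K−n−1) + 2t) ≤ ½` and `t_∂` is above `2CB₃·4·(that)`.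
[cite: Balaban1985Variational, (17) p.279, (144)–(147) pp.300–301, (150)–(152) p.301, (157)–(159) pp.302–303, (164)–(165) p.304, (168) p.304; Balaban1985RegularSpaces, p.98, Lemma 1 (1.25) p.79; Balaban1985Averaging, Prop. 2 p.22; Balaban1984PropagatorsII, (2.1)–(2.4) p.224, Cor. 2.8 (2.150)–(2.151) p.249] -/
theorem localGaugeSplitOn_of_gauge152_recordShearTildeTower_at_token_cubeDomains_box (F : T4Family) (N : ℕ) [NeZero N] :
    ∃ (Mh₀ R₀ : ℕ) (C δ₀ δ₁ B₃ : ℝ), 0 ≤ C ∧ 0 < δ₀ ∧ 0 < δ₁ ∧ 0 < B₃ ∧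
    ∀ (n K : ℕ) (_ : 1 ≤ K - n) (_ : K - n + 1 ≤ F.m + K) (hk : K - n ≤ (F.P K).m + (F.P K).K)
      {Mh R a' : ℕ} (_ : Mh = F.L ^ a') (_ : Mh₀ ≤ Mh) (_ : R₀ ≤ R) (_ : a' + 3 ≤ F.m + n)
      -- ★ THE TOKEN: floor ∕ period ∕ `a₀`-smallness side letters, print's numerics `ν`, the separated sequence of record, admissibility, the radii `ε`, the datum `(Mc, ρ, idx)` of level `K − n` with its box-form meet
      {Mc ρ c c₀ : ℕ} (_ : F.L * (Mc + 11 * 4 + 4 * ρ + 2 * (F.L + ((4 + 4) * F.L + 2))) + 3 ≤ c) (_ : Mc + 11 * 4 + 6 * ρ + 1 ≤ 2 * F.L ^ c₀)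
      {a₀ : ℝ} (_ : 143 * ((16 : ℝ) ^ 2) * ((F.L : ℝ) ^ 2 * a₀) ≤ 1 / 3) (_ : 2 * ((F.L : ℝ) ^ 2 * a₀) ≤ 2 * deltaSU (Fin N) / (((8 * F.L : ℕ) : ℝ)) ^ 2)
      (ν : Stage7Numerics) {Mν : ℕ} (g : ℕ → ℝ) (kk : ℕ) (s : SeqOfRecord F ν Mν g K kk) (_ : Sect2.SeqSeparated ν.M₁ s) (_ : c ≤ ν.M₁ ∧ kk + c₀ ≤ F.m + K) (_ : K - n ≤ kk)
      (εf : ℕ → ℝ) (_ : ∀ m, m ≤ kk → 0 < εf m ∧ εf m ≤ a₀) {idx : Pt (F.P K).d}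
      (_ : ∃ x ∈ box (F.P K).L (cornerP (F.P K) Mc ρ idx) (sideP (F.P K) Mc ρ) (K - n), ∃ y : Pt (F.P K).d, cover (F.P K) y ∈ s.Ω (K - n) ∧ Within ((3 : ℕ) : ℤ) x y)
      (_ : F.L * Mh ∣ ρ) (_ : ∀ i, ((F.L * Mh : ℕ) : ℤ) ∣ (cornerP (F.P K) Mc ρ idx) i) (_ : F.L * Mh ∣ (sideP (F.P K) Mc ρ)) (_ : F.L * Mh ∣ (F.P K).sitesPerDir (K - n)) (_ : R * (F.L * Mh) ≤ ρ)
      (_ : F.L ≤ ρ) (_ : Set.InjOn (cover (F.P K)) (cube (F.P K).L (cornerP (F.P K) Mc ρ idx) (sideP (F.P K) Mc ρ) ρ (K - n) 0))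
      {HV : (BondIdx (cubeDomains (F.P K) (cornerP (F.P K) Mc ρ idx) (sideP (F.P K) Mc ρ) ρ (K - n) hk) → MatA N) →ₗ[ℂ] (PBond (F.P K) 0 → MatA N)}
      (_ : ∀ (B' : BondIdx (cubeDomains (F.P K) (cornerP (F.P K) Mc ρ idx) (sideP (F.P K) Mc ρ) ρ (K - n) hk) → MatA N) (b : PBond (F.P K) 0),
        HV B' b = ∑ c, ((flatH (F.P K) (K - n) (cubeDomains (F.P K) (cornerP (F.P K) Mc ρ idx) (sideP (F.P K) Mc ρ) ρ (K - n) hk) (Pi.single c 1) b : ℝ) : ℂ) • B' c)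
      -- the CANONICAL level boxes of the tower (four equation binders)
      {lo hi : ℕ → Pt (F.P K).d}
      (_ : lo 0 = fun i => ((F.P K).L : ℤ) * (sqLo (F.P K).L (cornerP (F.P K) Mc ρ idx) ρ (K - n) 1 i - 1))
      (_ : hi 0 = fun i => ((F.P K).L : ℤ) * (sqHi (F.P K).L (cornerP (F.P K) Mc ρ idx) (sideP (F.P K) Mc ρ) ρ (K - n) 1 i + 1) + (((F.P K).L : ℤ) - 1))
      (_ : ∀ j, 1 ≤ j → lo j = sqLo (F.P K).L (cornerP (F.P K) Mc ρ idx) ρ (K - n) j - 1) (_ : ∀ j, 1 ≤ j → hi j = sqHi (F.P K).L (cornerP (F.P K) Mc ρ idx) (sideP (F.P K) Mc ρ) ρ (K - n) j + 1)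
      -- S3's gauge of `U` on the window, the (159)-splitting of `A − H_V X`
      {U : GaugeField (F.P K) 0 (SU N)} (u : GaugeTransf (F.P K) 0 (SU N)) {A : PBond (F.P K) 0 → MatA N} {t : ℝ}
      (_ : ∀ b ∈ (Sect2.regionOfSet (F.P K) (cover (F.P K) '' box (F.P K).L (cornerP (F.P K) Mc ρ idx) (sideP (F.P K) Mc ρ) (K - n))).bonds,
        gaugeU (fun x => ιSU N (u x)) (fun b' => ιSU N (U b')) b = expI ((F.P K).eta (K - n)) (A b))
      (_ : ∀ b ∈ (Sect2.regionOfSet (F.P K) (cover (F.P K) '' box (F.P K).L (cornerP (F.P K) Mc ρ idx) (sideP (F.P K) Mc ρ) (K - n))).bonds, ‖A b‖ < t)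
      (_ : ∀ q ∈ (Sect2.regionOfSet (F.P K) (cover (F.P K) '' box (F.P K).L (cornerP (F.P K) Mc ρ idx) (sideP (F.P K) Mc ρ) (K - n))).dpairs,
        ‖grad ((F.P K).eta (K - n)) q.2.1 (fun y => A ⟨y, q.2.2⟩) q.1‖ < t)
      -- ★ the Landau side of the shear: the (152) equation and letter on (cornerP (F.P K) Mc ρ idx) bond set containing the fine bonds of `□̃` (LOCATED-LANDAU-REGION), `0 ≤ t`, `η t ≤ 1`
      (_ : 0 ≤ t) (_ : (F.P K).eta (K - n) * t ≤ 1) {B : Set (PBond (F.P K) 0)}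
      (_ : ∀ b ∈ B, gaugeU (fun x => ιSU N (u x)) (fun b' => ιSU N (U b')) b = expI ((F.P K).eta (K - n)) (A b)) (_ : ∀ b ∈ B, ‖A b‖ < t)
      (_ : ∀ b : PBond (F.P K) 0,
        b.src ∈ (castSite '' Set.Icc (tlo (F.P K).L (tLo (cornerP (F.P K) Mc ρ idx) ρ) (K - n - 0)) (thi (F.P K).L (tHi (cornerP (F.P K) Mc ρ idx) (sideP (F.P K) Mc ρ) ρ) (K - n - 0)) : Set (Site (F.P K) 0)) →
        b.tgt ∈ (castSite '' Set.Icc (tlo (F.P K).L (tLo (cornerP (F.P K) Mc ρ idx) ρ) (K - n - 0)) (thi (F.P K).L (tHi (cornerP (F.P K) Mc ρ idx) (sideP (F.P K) Mc ρ) ρ) (K - n - 0)) : Set (Site (F.P K) 0)) → b ∈ B)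
      -- ★ the token's (17) clause along the sequence (level `K − n − 1` is read)
      (_ : ∀ m, m ≤ kk → PlaqSmallOn (Sect2.omegaPlaqsTop s.Ω (suppDomOfRecord F ν K s.Ω) m) (εf m * (F.P K).eta m ^ 2) U),
      ∃ uL : GaugeTransf (F.P K) 0 (SU N),
        (∀ i < K - n, AxialGauge (radialContourData (F.P K) i (SU N)) (Averaging.iter (avOfRecord F N K) i (gaugeAct uL (gaugeAct u U)))) ∧
        ∀ (lam : (j : ℕ) → Site (F.P K) j → MatA N)
          (_ : ∀ (j : ℕ) (y : Site (F.P K) j), ‖lam j y‖ ≤ ‖mlog (((((toMS uL j (castSite (lo j)))⁻¹ * toMS uL j y)⁻¹ : SU N)) : MatA N)‖)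
          {X : BondIdx (cubeDomains (F.P K) (cornerP (F.P K) Mc ρ idx) (sideP (F.P K) Mc ρ) ρ (K - n) hk) → MatA N}
          (_ : ∀ c : BondIdx (cubeDomains (F.P K) (cornerP (F.P K) Mc ρ idx) (sideP (F.P K) Mc ρ) ρ (K - n) hk),
            X c = LatticeFieldCalculus.grad (((F.P K).L : ℝ) ^ (K - n) / ((F.P K).L : ℝ) ^ (c.1.1 : ℕ)) (lam c.1.1) c.1.2)
          {A₁ A₂ A₃ : PBond (F.P K) 0 → MatA N} {t₁ t₂ t₃ : ℝ}
          (_ : ∀ b, A b - HV X b = A₁ b + A₂ b - A₃ b)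
          (_ : Letters10On (cover (F.P K) '' box (F.P K).L (cornerP (F.P K) Mc ρ idx) (sideP (F.P K) Mc ρ) (K - n)) ((F.P K).eta (K - n)) t₁ A₁)
          (_ : Letters10On (cover (F.P K) '' box (F.P K).L (cornerP (F.P K) Mc ρ idx) (sideP (F.P K) Mc ρ) (K - n)) ((F.P K).eta (K - n)) t₂ A₂)
          (_ : Letters10On (cover (F.P K) '' box (F.P K).L (cornerP (F.P K) Mc ρ idx) (sideP (F.P K) Mc ρ) (K - n)) ((F.P K).eta (K - n)) t₃ A₃)
          -- ★ ONE smallness on the AFFINE shear letter at `α₀ := L²ε(K−n−1)`, `v_k := (d−1)(M′+4ρ−1)·2L²ε(K−n−1)` (module 40 ∕ (147) at the representative)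
          (_ : 2 * (((F.P K).d : ℝ) * ((((sideP (F.P K) Mc ρ) + 4 * ρ + 1 : ℕ) : ℝ) * (4 * ((((F.P K).d * ((F.P K).L - 1) + 1 : ℕ) : ℝ) * ((((F.P K).d - 1 : ℕ) : ℝ) * (((F.P K).L - 1 : ℕ) : ℝ)) + 7 * (((((F.P K).d + 2) * (F.P K).L : ℕ) : ℝ) ^ 2 / 4) + ((((F.P K).d + 1) * ((F.P K).L - 1) : ℕ) : ℝ) * ((((F.P K).d * ((F.P K).L - 1) + 1 : ℕ) : ℝ) * ((((F.P K).d - 1 : ℕ) : ℝ) * (((F.P K).L - 1 : ℕ) : ℝ)))) * (((F.P K).L : ℝ) ^ 2 * εf (K - n - 1)) + ((((F.P K).d - 1 : ℕ) : ℝ) * ((sideP (F.P K) Mc ρ + 4 * ρ - 1 : ℕ) : ℝ) * (2 * (((F.P K).L : ℝ) ^ 2 * εf (K - n - 1)))) + 2 * t))) ≤ 1 / 2)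
          {tD : ℝ} (_ : 2 * C * B₃ * (4 * (2 * (((F.P K).d : ℝ) * ((((sideP (F.P K) Mc ρ) + 4 * ρ + 1 : ℕ) : ℝ) * (4 * ((((F.P K).d * ((F.P K).L - 1) + 1 : ℕ) : ℝ) * ((((F.P K).d - 1 : ℕ) : ℝ) * (((F.P K).L - 1 : ℕ) : ℝ)) + 7 * (((((F.P K).d + 2) * (F.P K).L : ℕ) : ℝ) ^ 2 / 4) + ((((F.P K).d + 1) * ((F.P K).L - 1) : ℕ) : ℝ) * ((((F.P K).d * ((F.P K).L - 1) + 1 : ℕ) : ℝ) * ((((F.P K).d - 1 : ℕ) : ℝ) * (((F.P K).L - 1 : ℕ) : ℝ)))) * (((F.P K).L : ℝ) ^ 2 * εf (K - n - 1)) + ((((F.P K).d - 1 : ℕ) : ℝ) * ((sideP (F.P K) Mc ρ + 4 * ρ - 1 : ℕ) : ℝ) * (2 * (((F.P K).L : ℝ) ^ 2 * εf (K - n - 1)))) + 2 * t))))) < tD),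
          LocalGaugeSplitOn (cover (F.P K) '' box (F.P K).L (cornerP (F.P K) Mc ρ idx) (sideP (F.P K) Mc ρ) (K - n)) ((F.P K).eta (K - n)) t (t₁ + (t₂ + tD) + t₃) U := by
  obtain ⟨Mh₀, R₀, C, δ₀, δ₁, B₃, hC, hδ₀, hδ₁, hB₃, hmain⟩ := localGaugeSplitOn_of_gauge152_recordShearTildeTower_of_fine_cubeDomains_box F N
  refine ⟨Mh₀, R₀, C, δ₀, δ₁, B₃, hC, hδ₀, hδ₁, hB₃, ?_⟩
  intro n K hk1 hk' hk Mh R a' hMha hMh hR hsize Mc ρ c c₀ hcE hc₀ a₀ ha3 ha2 ν Mν g kk s hsep hadm hnk εf hε idx hdat hρ ha hM hper hRρ hLρ hinj HV hHV lo hi hlo0 hhi0 hloj hhij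
    U u A t he hA hdA ht0 hηt B heB hAB hB h17
  have hρP : (F.P K).L ≤ ρ := by rw [T4Family.P_L]; exact hLρ
  have hρ0 : 0 < ρ := lt_of_lt_of_le (F.P K).L_pos hρP
  have hM1 : 1 ≤ sideP (F.P K) Mc ρ := by have := le_sideP (P := F.P K) Mc hρ0; omega
  -- dag-n07-w6 g3: the ranges at `α₀ := L²ε(K−n−1)`, the widened-□̃ fine regularity from (17) one level down, the radial shear gauge and its rows
  obtain ⟨hα, hα3, hα2⟩ := alpha_ranges_of_le (F := F) (N := N) K (hε (K - n - 1) (by omega)).1 (hε (K - n - 1) (by omega)).2 ha3 ha2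
  have h52 := plaqSmallOn_tildeTowerWide_at_token (F := F) (N := N) hcE ν g K kk s hsep hadm εf U h17 hk1 hnk idx hdat
  obtain ⟨uL, hax, hrows, -⟩ := exists_shearGauge_radialRep_rows_at_token (F := F) (N := N) hcE hc₀ ha3 ha2 ν g K kk hρP s hsep hadm εf hε U h17 hk1 hnk idx hdat
    hlo0 hhi0 hloj hhij u
  refine ⟨uL, hax, ?_⟩
  intro lam hlam X hX A₁ A₂ A₃ t₁ t₂ t₃ h159 h₁ h₂ h₃ hςaff tD htD
  -- the top letter on `□̃^{(K−n)}`: the level-`(K−n)` row of the □̃-tower (empty sum)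
  have htop : ∀ c' : PBond (F.P K) (K - n),
      c'.src ∈ (castSite '' Set.Icc (tlo (F.P K).L (tLo (cornerP (F.P K) Mc ρ idx) ρ) (K - n - (K - n))) (thi (F.P K).L (tHi (cornerP (F.P K) Mc ρ idx) (sideP (F.P K) Mc ρ) ρ) (K - n - (K - n))) :
        Set (Site (F.P K) (K - n))) →
      c'.tgt ∈ (castSite '' Set.Icc (tlo (F.P K).L (tLo (cornerP (F.P K) Mc ρ idx) ρ) (K - n - (K - n))) (thi (F.P K).L (tHi (cornerP (F.P K) Mc ρ idx) (sideP (F.P K) Mc ρ) ρ) (K - n - (K - n))) :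
        Set (Site (F.P K) (K - n))) →
      dist1 (Averaging.iter (avOfRecord F N K) (K - n) (gaugeAct uL (gaugeAct u U)) c') ≤
        (((F.P K).d - 1 : ℕ) : ℝ) * ((sideP (F.P K) Mc ρ + 4 * ρ - 1 : ℕ) : ℝ) * (2 * (((F.P K).L : ℝ) ^ 2 * εf (K - n - 1))) := by
    intro c' hs htg
    have h := hrows (K - n) le_rfl c' hs htg
    simpa only [Finset.Ico_self, Finset.sum_empty, mul_zero, add_zero] using h
  have hvk : (0 : ℝ) ≤ (((F.P K).d - 1 : ℕ) : ℝ) * ((sideP (F.P K) Mc ρ + 4 * ρ - 1 : ℕ) : ℝ) * (2 * (((F.P K).L : ℝ) ^ 2 * εf (K - n - 1))) := by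
    have := (hε (K - n - 1) (by omega)).1; positivity
  exact hmain n K hk1 hk' hk hMha hMh hR hsize hM1 hρ ha hM hper hRρ hLρ hinj hHV hlo0 hhi0 hloj hhij uL lam hlam hX u he hA hdA h159 h₁ h₂ h₃
    ht0 hηt heB hAB hB hα hα3 hα2 h52 hvk hax htop hςaff htD

end Summit.QuantumFields.YangMills.BalabanUVNodes.N07ShearLetterAtToken

end
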